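import Summits.CriticalPhenomena.SAWScalingLimit.Theses.SAWTrackTransport
import HarnessLib

/-! # First lemmas of line `tip_kernel` (crux stmt-CriticalPhenomena-16965) — typed signatures, `sorry` throughout

Crux WORKFILE (not a skeleton, not registered): the provable-now lemmas L2–L5 named in `Lines/tip_kernel.md` and
`STRATEGY-CENSUS.md`, stated over existing declarations so that they elaborate; a prover lands each under `Theorems/`
`--supports stmt-CriticalPhenomena-16965` after `ledger workitem stub-add … --name <name> --signature '<sig>'`.
Strategist unit `cstrat-stmt-CriticalPhenomena-16965-b1`, 2026-08-17. -/

noncomputable section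
open scoped Topology ENNReal NNReal
open MeasureTheory Filter Set
open Literature.Probability.RandomPlanarGeometry
open Literature.Probability.RandomPlanarGeometry.SAW.YangBaxter

namespace Summit.CriticalPhenomena.SAWScalingLimit.Cruxes.AxiomsOfLimit.TipKernel.FirstLemmas

/-- L4 — WEIGHT DOMINATION at the square point: a half-used face revisited costs `w₁/u₁ ≤ u₁`, i.e. the
decorated one-arc weight is dominated by the undecorated one (numerically `0.11267 ≤ 0.16678`, ratio `0.675`;
`w₂(π/2) = w₁(π/2)`, `u₂(π/2) = u₁(π/2)` by the `θ ↔ π − θ` symmetry of GM eq. (1)). -/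
theorem weightW1_half_pi_le_sq : weightW1 (Real.pi / 2) ≤ weightU1 (Real.pi / 2) ^ 2 := by
  sorry

theorem weightW2_half_pi_le_sq : weightW2 (Real.pi / 2) ≤ weightU2 (Real.pi / 2) ^ 2 := by
  sorry

theorem weightU1_half_pi_eq_weightU2 : weightU1 (Real.pi / 2) = weightU2 (Real.pi / 2) := by
  sorry

theorem weightW1_half_pi_eq_weightW2 : weightW1 (Real.pi / 2) = weightW2 (Real.pi / 2) := by
  sorry

/-- L3 — TOTAL-VARIATION DOMINATION (abstract): if `ν ≤ μ` setwise and `ν = μ` on the sets avoiding `A`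
(the decorated and undecorated walk measures agree off the event "a decorated face is used"), then the
NORMALISED measures are `2 μ(A)/μ(univ)`-close on every measurable set. -/
theorem abs_cond_sub_cond_le {α : Type*} [MeasurableSpace α] (μ ν : Measure α) [IsFiniteMeasure μ]
    (A : Set α) (hle : ν ≤ μ) (heq : ∀ S, MeasurableSet S → Disjoint S A → ν S = μ S)
    (S : Set α) (hS : MeasurableSet S) :
    |(ν.real Set.univ)⁻¹ * ν.real S - (μ.real Set.univ)⁻¹ * μ.real S| ≤
      2 * μ.real A / μ.real Set.univ := by
  sorry

/-- L5 — EXACT LATTICE RESTRICTION for Glazman–Manolescu's walk (any angles, any fugacity): the weight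
measure of `Ω_δ` restricted to the walks drawing all their arcs in rhombi of `Ω'_δ ⊆ Ω_δ` IS the weight
measure of `Ω'_δ` (local weights; empty rhombi weigh `1`; `YBWalk.weight_mapDomain`). -/
theorem ybWeight_restrict_range_mapDomain (Θ : ℤ → ℝ) {Ω Ω' : Set ℂ} (h : Ω' ⊆ Ω) (δ x : ℝ)
    (a b : MidEdge) :
    (ybWeight Θ Ω δ x a b).restrict (Set.range (YBWalk.mapDomain (a := a) (z := b) (meshFaces_mono Θ h δ))) =
      (ybWeight Θ Ω' δ x a b).map (YBWalk.mapDomain (meshFaces_mono Θ h δ)) := by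
  sorry

/-- L5' — the same for the laws: conditioning the law of `Ω_δ` on "all arcs in `Ω'_δ`" gives the law of
`Ω'_δ` (when the latter is a genuine probability measure). -/
theorem ybLaw_cond_range_mapDomain (Θ : ℤ → ℝ) {Ω Ω' : Set ℂ} (h : Ω' ⊆ Ω) (δ x : ℝ) (a b : MidEdge)
    (h0 : ybWeight Θ Ω' δ x a b Set.univ ≠ 0) (htop : ybWeight Θ Ω δ x a b Set.univ ≠ ⊤) :
    ProbabilityTheory.cond (ybLaw Θ Ω δ x a b)
        (Set.range (YBWalk.mapDomain (a := a) (z := b) (meshFaces_mono Θ h δ))) =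
      (ybLaw Θ Ω' δ x a b).map (YBWalk.mapDomain (meshFaces_mono Θ h δ)) := by
  sorry

/-- L2 — THE DECORATED FUTURE (shape of the statement; the decorated weight is described in the card):
for a charged prefix `ω` the conditional weight of a walk extending `ω` FACTORS through the faces: faces
used only by `ω` contribute their `ω`-weight, fresh faces their own local weight, and a HALF-USED face
revisited by the future contributes `w_κ` in place of `u_κ · u_κ`. Typed here in its weakest useful
form — domination of the conditional weight by (prefix weight) × (undecorated future weight) — which is
all that L3 consumes. -/
theorem weight_le_prefix_mul_suffix (Θ : ℤ → ℝ) (hΘ : ∀ k, Θ k ∈ Set.Icc (Real.pi / 3) (2 * Real.pi / 3))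
    (hdom : ∀ k, weightW1 (Θ k) ≤ weightU1 (Θ k) ^ 2 ∧ weightW2 (Θ k) ≤ weightU2 (Θ k) ^ 2)
    {D : Set Face} {a t b : MidEdge} (ω : YBWalk D a t) (η : YBWalk D t b) (γ : YBWalk D a b)
    (hγ : γ.mids = ω.mids ++ η.mids.tail) :
    γ.weight Θ ≤ ω.weight Θ * η.weight Θ := by
  sorry

end Summit.CriticalPhenomena.SAWScalingLimit.Cruxes.AxiomsOfLimit.TipKernel.FirstLemmas
end
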